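import Mathlib
import Literature.Analysis.FluidPDE.OctahedralSymmetry
import Literature.MathematicalPhysics.QuantumLattice.EuclideanAction
import HarnessLib

/-!
# Exponent reduction for the shell-rigidity crux (`stub_exponentReduction`)

Summit `QuantumFields/YangMills`, thesis `PencilRigidity.ShellRigidity` (stmt-QuantumFields-11685),
line `transverse-smearing-planar-threshold`, stub 1.

A `W(B₄)`-symmetric kernel `K` on `ℝ⁴` which is pointwise OS-positive across the hyperplane
`x₀ = 0` and obeys `|K x| ≤ C (1 + ‖x‖ ^ (η - 10))` obeys the same bound with `η` replaced by
`min η 7`.  The only issue is boundedness of `K` off the unit ball, which follows from positivity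
alone: the axis profile `f t = K (t e₀)` is nonnegative, midpoint log-convex and of polynomial
growth, hence non-increasing on `(0, ∞)`, and it dominates the kernel, `|K x| ≤ f |x_μ|` whenever
`x_μ ≠ 0` (a `2 × 2` Gram minor of the positivity).  Neither continuity nor `η > 0` is needed.
The `W(B₄)` elements used (coordinate mirrors, transpositions, `-1`) come from the tree's
hyperoctahedral toolkit `Literature.Analysis.FluidPDE.OctahedralSymmetry`. [folklore]
-/

noncomputable section

namespace Summit.QuantumFields.YangMills.Cruxes.ShellRigidity.TransverseSmearingPlanarThreshold

open scoped BigOperators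
open Literature.MathematicalPhysics.QuantumLattice
open Literature.Analysis.FluidPDE (mirrorReflection mirrorReflection_apply
  isSignedPermIsometry_mirrorReflection swapReflection swapReflection_apply
  isSignedPermIsometry_swapReflection isSignedPermIsometry_neg)

namespace ExponentReduction

/-! ### Two real-variable lemmas -/

/-- `2 × 2` Gram inequality: if the real quadratic form `∑ᵢⱼ cᵢ cⱼ F i j` on `Fin 2` is nonnegative
and `F 1 0 = F 0 1`, then `F 0 1 ^ 2 ≤ F 0 0 * F 1 1`. [folklore] -/
theorem offDiag_sq_le_mul {F : Fin 2 → Fin 2 → ℝ} (hsymm : F 1 0 = F 0 1)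
    (h : ∀ c : Fin 2 → ℝ, 0 ≤ ∑ i, ∑ j, c i * c j * F i j) :
    F 0 1 ^ 2 ≤ F 0 0 * F 1 1 := by
  have key : ∀ u v : ℝ, 0 ≤ F 0 0 * u ^ 2 + 2 * F 0 1 * (u * v) + F 1 1 * v ^ 2 := by
    intro u v
    have h' := h ![u, v]
    simp only [Fin.sum_univ_two, Matrix.cons_val_zero, Matrix.cons_val_one, hsymm] at h'
    linarith
  have ha : 0 ≤ F 0 0 := by nlinarith [key 1 0]
  rcases ha.eq_or_lt with ha0 | hapos
  · have hb : F 0 1 = 0 := by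
      by_contra hb
      have h' := key (-(F 1 1 + 1) / (2 * F 0 1)) 1
      have e : 2 * F 0 1 * (-(F 1 1 + 1) / (2 * F 0 1) * 1) = -(F 1 1 + 1) := by
        field_simp
      rw [← ha0, e] at h'
      linarith
    rw [hb, ← ha0]
    simp
  · nlinarith [key (-F 0 1) (F 0 0)]

/-- A nonnegative, midpoint log-convex function on `(0, ∞)` of polynomial growth at infinity is
non-increasing. [folklore] -/
theorem antitone_of_midLogConvex {f : ℝ → ℝ} {A : ℝ} {p : ℕ}
    (hf0 : ∀ t, 0 < t → 0 ≤ f t)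
    (hconv : ∀ a b, 0 < a → 0 < b → f ((a + b) / 2) ^ 2 ≤ f a * f b)
    (hbd : ∀ u, 1 ≤ u → f u ≤ A * u ^ p)
    {s t : ℝ} (hs : 0 < s) (hst : s ≤ t) : f t ≤ f s := by
  rcases hst.eq_or_lt with rfl | hst'
  · exact le_rfl
  by_contra hlt
  push Not at hlt
  have hft : 0 < f t := (hf0 s hs).trans_lt hlt
  have hfs : 0 < f s := by
    rcases (hf0 s hs).eq_or_lt with h0 | h0
    · have h := hconv s (2 * t - s) hs (by linarith)
      rw [show (s + (2 * t - s)) / 2 = t by ring, ← h0, zero_mul] at h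
      nlinarith
    · exact h0
  have hA : 0 ≤ A := by
    have h := hbd 1 le_rfl
    exact (hf0 1 one_pos).trans (by rwa [one_pow, mul_one] at h)
  set d := t - s with hd
  have hdpos : 0 < d := by rw [hd]; linarith
  set r := f t / f s with hr
  have hr1 : 1 < r := by rw [hr]; exact (one_lt_div hfs).2 hlt
  have hr0 : 0 < r := one_pos.trans hr1
  -- the ratios `f (s + (n+1) d) / f (s + n d)` do not decrease along the progression
  have key : ∀ n : ℕ, r * f (s + n * d) ≤ f (s + (n + 1) * d) ∧ 0 < f (s + n * d) := by
    intro n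
    induction n with
    | zero => exact ⟨by simp [hr, hd, hfs.ne'], by simpa using hfs⟩
    | succ k ih =>
      obtain ⟨ih1, ih0⟩ := ih
      have hu0 : 0 < s + k * d := by positivity
      have hu2 : 0 < s + (k + 2) * d := by positivity
      have h1 : 0 < f (s + (k + 1) * d) := (mul_pos hr0 ih0).trans_le ih1
      have h2 : 0 ≤ f (s + (k + 2) * d) := hf0 _ hu2
      have hc := hconv _ _ hu0 hu2
      rw [show (s + k * d + (s + (k + 2) * d)) / 2 = s + (k + 1) * d by ring] at hc
      refine ⟨?_, by push_cast; exact h1⟩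
      push_cast
      rw [show ((k : ℝ) + 1 + 1) = k + 2 by ring]
      have h3 : f (s + (k + 1) * d) * (r * f (s + (k + 1) * d)) ≤
          f (s + (k + 1) * d) * f (s + (k + 2) * d) :=
        calc f (s + (k + 1) * d) * (r * f (s + (k + 1) * d))
              = r * f (s + (k + 1) * d) ^ 2 := by ring
          _ ≤ r * (f (s + k * d) * f (s + (k + 2) * d)) :=
              mul_le_mul_of_nonneg_left hc hr0.le
          _ = r * f (s + k * d) * f (s + (k + 2) * d) := by ring
          _ ≤ f (s + (k + 1) * d) * f (s + (k + 2) * d) :=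
              mul_le_mul_of_nonneg_right ih1 h2
      exact le_of_mul_le_mul_left h3 h1
  have growth : ∀ n : ℕ, f s * r ^ n ≤ f (s + n * d) := by
    intro n
    induction n with
    | zero => simp
    | succ k ih =>
      calc f s * r ^ (k + 1) = r * (f s * r ^ k) := by ring
        _ ≤ r * f (s + k * d) := mul_le_mul_of_nonneg_left ih hr0.le
        _ ≤ f (s + (k + 1) * d) := (key k).1
        _ = f (s + ((k + 1 : ℕ) : ℝ) * d) := by push_cast; ring_nf
  -- exponential growth against the polynomial bound
  set B := A * (s + d) ^ p with hB
  have hlim : Filter.Tendsto (fun n : ℕ => B * ((n : ℝ) ^ p / r ^ n)) Filter.atTop (nhds 0) := by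
    simpa using (tendsto_pow_const_div_const_pow_of_one_lt p hr1).const_mul B
  have hev₁ : ∀ᶠ n : ℕ in Filter.atTop, B * ((n : ℝ) ^ p / r ^ n) < f s :=
    hlim.eventually (gt_mem_nhds hfs)
  have hev₂ : ∀ᶠ n : ℕ in Filter.atTop, 1 ≤ (n : ℝ) * d :=
    (tendsto_natCast_atTop_atTop.atTop_mul_const hdpos).eventually_ge_atTop 1
  obtain ⟨N, hN₁, hN₂⟩ := (hev₁.and hev₂).exists
  have hNpos : (1 : ℝ) ≤ N := by
    have hN : N ≠ 0 := by rintro rfl; norm_num at hN₂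
    exact_mod_cast Nat.one_le_iff_ne_zero.2 hN
  have hu1 : 1 ≤ s + N * d := by linarith
  have hu_le : s + N * d ≤ N * (s + d) := by nlinarith
  have hu0 : 0 ≤ s + N * d := by linarith
  have h5 : f s * r ^ N ≤ B * (N : ℝ) ^ p :=
    calc f s * r ^ N ≤ f (s + N * d) := growth N
      _ ≤ A * (s + N * d) ^ p := hbd _ hu1
      _ ≤ A * ((N : ℝ) * (s + d)) ^ p :=
          mul_le_mul_of_nonneg_left (pow_le_pow_left₀ hu0 hu_le p) hA
      _ = B * (N : ℝ) ^ p := by rw [hB, mul_pow]; ring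
  have h6 : f s ≤ B * ((N : ℝ) ^ p / r ^ N) := by
    rwa [mul_div_assoc', le_div_iff₀ (pow_pos hr0 N)]
  linarith

/-! ### Signed-permutation symmetries of the kernel -/

section Kernel

variable {K : EuclideanSpace ℝ (Fin 4) → ℝ}
  (hW : ∀ R : EuclideanSpace ℝ (Fin 4) ≃ₗᵢ[ℝ] EuclideanSpace ℝ (Fin 4),
    (∀ i : Fin 4, ∃ j : Fin 4, R (EuclideanSpace.single i 1) = EuclideanSpace.single j 1 ∨
      R (EuclideanSpace.single i 1) = -EuclideanSpace.single j 1) →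
    ∀ x : EuclideanSpace ℝ (Fin 4), K (R x) = K x)
include hW

/-- Invariance of `K` under the mirror `x_k ↦ -x_k` (coordinate form). [folklore] -/
theorem K_flip (k : Fin 4) (x y : EuclideanSpace ℝ (Fin 4))
    (h : ∀ i, y i = if i = k then -x i else x i) : K y = K x := by
  have hy : y = mirrorReflection k x := by
    ext i; rw [h i, mirrorReflection_apply]
  rw [hy]
  exact hW _ (isSignedPermIsometry_mirrorReflection k) x

/-- Invariance of `K` under the transposition of two coordinates (coordinate form). [folklore] -/
theorem K_swap (k l : Fin 4) (x y : EuclideanSpace ℝ (Fin 4))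
    (h : ∀ i, y i = x (Equiv.swap k l i)) : K y = K x := by
  have hy : y = swapReflection k l x := by
    ext i; rw [h i, swapReflection_apply]
  rw [hy]
  exact hW _ (isSignedPermIsometry_swapReflection k l) x

/-- `K` is even (`-1 ∈ W(B₄)`). [folklore] -/
theorem K_neg (x : EuclideanSpace ℝ (Fin 4)) : K (-x) = K x :=
  hW (LinearIsometryEquiv.neg ℝ) isSignedPermIsometry_neg x

/-- `K` is invariant under time reflection. [folklore] -/
theorem K_theta (x : EuclideanSpace ℝ (Fin 4)) : K (timeReflection 4 x) = K x :=
  K_flip hW 0 x _ fun i => by rw [timeReflection_apply]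

/-- Spatial parity, coordinate form: `K (x₀, -x⃗) = K (x₀, x⃗)`. [folklore] -/
theorem K_parity (x y : EuclideanSpace ℝ (Fin 4)) (h0 : y 0 = x 0) (h : ∀ i, i ≠ 0 → y i = -x i) :
    K y = K x := by
  rw [← K_neg hW x]
  refine K_flip hW 0 (-x) y fun i => ?_
  split_ifs with hi
  · rw [hi, h0, PiLp.neg_apply, neg_neg]
  · rw [h i hi, PiLp.neg_apply]

/-- `K (θ (u e₀) - v e₀) = f (u + v)`, as `θ (u e₀) - v e₀ = -(u + v) e₀` and `K` is even.
[folklore] -/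
theorem K_theta_single (u v : ℝ) :
    K (timeReflection 4 (EuclideanSpace.single 0 u) - EuclideanSpace.single 0 v) =
      K (EuclideanSpace.single 0 (u + v)) := by
  rw [← K_neg hW (EuclideanSpace.single 0 (u + v))]
  congr 1
  ext i
  fin_cases i
  · simp [timeReflection_apply]; ring
  all_goals simp [timeReflection_apply]

/-! ### The axis profile `f t = K (t e₀)` -/

variable (hax : ∀ (m : ℕ) (x : Fin m → EuclideanSpace ℝ (Fin 4)) (c : Fin m → ℝ),
    (∀ i, 0 < x i 0) → 0 ≤ ∑ i, ∑ j, c i * c j * K (timeReflection 4 (x i) - x j))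
include hax

/-- `f t ≥ 0` for `t > 0` (positivity with one point `(t/2) e₀`). [folklore] -/
theorem axis_nonneg (t : ℝ) (ht : 0 < t) : 0 ≤ K (EuclideanSpace.single 0 t) := by
  have h := hax 1 (fun _ => EuclideanSpace.single 0 (t / 2)) (fun _ => 1)
    (fun _ => by simpa using half_pos ht)
  simp only [Finset.univ_unique, Finset.sum_singleton, one_mul] at h
  rwa [K_theta_single hW, add_halves] at h

/-- Log-convexity of the axis profile, sum form (the `2 × 2` Gram minor at `a e₀, b e₀`).
[folklore] -/
theorem axis_logConvex (a b : ℝ) (ha : 0 < a) (hb : 0 < b) :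
    K (EuclideanSpace.single 0 (a + b)) ^ 2 ≤
      K (EuclideanSpace.single 0 (a + a)) * K (EuclideanSpace.single 0 (b + b)) := by
  have h := offDiag_sq_le_mul (F := fun i j : Fin 2 =>
      K (timeReflection 4 (![EuclideanSpace.single 0 a, EuclideanSpace.single 0 b] i) -
        ![EuclideanSpace.single 0 a, EuclideanSpace.single 0 b] j))
    (by simp only [Matrix.cons_val_zero, Matrix.cons_val_one, K_theta_single hW, add_comm b a])
    (fun c => hax 2 _ c (fun i => by fin_cases i <;> simp [ha, hb]))
  simpa only [Matrix.cons_val_zero, Matrix.cons_val_one, K_theta_single hW] using h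

/-- Transverse domination at negative time: `|K x| ≤ f (-x₀)` when `x₀ < 0` (the `2 × 2` Gram
minor at `(t/2) e₀ + x⃗, (t/2) e₀`, `t = -x₀`, with spatial parity). [folklore] -/
theorem dom_of_neg (x : EuclideanSpace ℝ (Fin 4)) (hx : x 0 < 0) :
    |K x| ≤ K (EuclideanSpace.single 0 (-x 0)) := by
  set t := -x 0 with ht
  have htpos : 0 < t := by rw [ht]; linarith
  set x₁ : EuclideanSpace ℝ (Fin 4) := WithLp.toLp 2 ![t / 2, x 1, x 2, x 3] with hx₁
  set x₂ : EuclideanSpace ℝ (Fin 4) := EuclideanSpace.single 0 (t / 2) with hx₂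
  have e11 : K (timeReflection 4 x₁ - x₁) = K (EuclideanSpace.single 0 t) := by
    rw [← K_neg hW (EuclideanSpace.single 0 t)]
    congr 1
    ext i
    fin_cases i
    · simp [hx₁, timeReflection_apply]; ring
    all_goals simp [hx₁, timeReflection_apply]
  have e12 : K (timeReflection 4 x₁ - x₂) = K x := by
    congr 1
    ext i
    fin_cases i
    · simp [hx₁, hx₂, timeReflection_apply, ht]; ring
    all_goals simp [hx₁, hx₂, timeReflection_apply]
  have e21 : K (timeReflection 4 x₂ - x₁) = K x := by
    apply K_parity hW x
    · simp [hx₁, hx₂, timeReflection_apply, ht]; ring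
    · intro i hi
      fin_cases i
      · exact absurd rfl hi
      all_goals simp [hx₁, hx₂, timeReflection_apply]
  have e22 : K (timeReflection 4 x₂ - x₂) = K (EuclideanSpace.single 0 t) := by
    rw [hx₂, K_theta_single hW, add_halves]
  have h := offDiag_sq_le_mul
    (F := fun i j : Fin 2 => K (timeReflection 4 (![x₁, x₂] i) - ![x₁, x₂] j))
    (by simp only [Matrix.cons_val_zero, Matrix.cons_val_one, e12, e21])
    (fun c => hax 2 _ c (fun i => by fin_cases i <;> simp [hx₁, hx₂] <;> positivity))
  simp only [Matrix.cons_val_zero, Matrix.cons_val_one, e11, e12, e22] at h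
  exact abs_le_of_sq_le_sq (by rw [sq (K _)] at h ⊢; nlinarith [h]) (axis_nonneg hW hax t htpos)

/-- Transverse domination along the time axis: `|K x| ≤ f |x₀|` when `x₀ ≠ 0`. [folklore] -/
theorem dom_axis0 (x : EuclideanSpace ℝ (Fin 4)) (hx : x 0 ≠ 0) :
    |K x| ≤ K (EuclideanSpace.single 0 |x 0|) := by
  rcases lt_or_gt_of_ne hx with h | h
  · rw [abs_of_neg h]; exact dom_of_neg hW hax x h
  · simpa [K_theta hW, timeReflection_apply, abs_of_pos h] using
      dom_of_neg hW hax (timeReflection 4 x) (by simpa [timeReflection_apply] using h)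

/-- Transverse domination along any axis: `|K x| ≤ f |x_μ|` when `x_μ ≠ 0`. [folklore] -/
theorem dom_axis (μ : Fin 4) (x : EuclideanSpace ℝ (Fin 4)) (hx : x μ ≠ 0) :
    |K x| ≤ K (EuclideanSpace.single 0 |x μ|) := by
  set y : EuclideanSpace ℝ (Fin 4) := swapReflection (0 : Fin 4) μ x with hy
  have hy0 : y 0 = x μ := by rw [hy, swapReflection_apply, Equiv.swap_apply_left]
  have hKy : K y = K x := K_swap hW 0 μ x y fun i => by rw [hy, swapReflection_apply]
  rw [← hKy, ← hy0]
  exact dom_axis0 hW hax y (by rwa [hy0])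

omit hW hax in
/-- Polynomial growth of the axis profile from the crux bound. [folklore] -/
theorem axis_growth {C η : ℝ} (hC : 0 ≤ C)
    (hb : ∀ x : EuclideanSpace ℝ (Fin 4), x ≠ 0 → |K x| ≤ C * (1 + ‖x‖ ^ (η - 10))) (u : ℝ)
    (hu : 1 ≤ u) : K (EuclideanSpace.single 0 u) ≤ 2 * C * u ^ ⌈η⌉₊ := by
  have hu0 : 0 < u := one_pos.trans_le hu
  have hne : (EuclideanSpace.single 0 u : EuclideanSpace ℝ (Fin 4)) ≠ 0 := by
    rw [Ne, PiLp.single_eq_zero_iff]; exact hu0.ne'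
  have h := hb _ hne
  rw [PiLp.norm_single, Real.norm_eq_abs, abs_of_pos hu0] at h
  have h1 : u ^ (η - 10) ≤ u ^ ⌈η⌉₊ := by
    rw [← Real.rpow_natCast]
    exact Real.rpow_le_rpow_of_exponent_le hu (by linarith [Nat.le_ceil η])
  have h2 : (1 : ℝ) ≤ u ^ ⌈η⌉₊ := one_le_pow₀ hu
  calc K (EuclideanSpace.single 0 u) ≤ |K (EuclideanSpace.single 0 u)| := le_abs_self _
    _ ≤ C * (1 + u ^ (η - 10)) := h
    _ ≤ C * (u ^ ⌈η⌉₊ + u ^ ⌈η⌉₊) := mul_le_mul_of_nonneg_left (add_le_add h2 h1) hC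
    _ = 2 * C * u ^ ⌈η⌉₊ := by ring

omit hW hax in
/-- The constant of the crux bound is nonnegative. [folklore] -/
theorem const_nonneg {C η : ℝ}
    (hb : ∀ x : EuclideanSpace ℝ (Fin 4), x ≠ 0 → |K x| ≤ C * (1 + ‖x‖ ^ (η - 10))) : 0 ≤ C := by
  have hne : (EuclideanSpace.single 0 (1 : ℝ) : EuclideanSpace ℝ (Fin 4)) ≠ 0 := by
    rw [Ne, PiLp.single_eq_zero_iff]; exact one_ne_zero
  have h := hb _ hne
  rw [PiLp.norm_single, norm_one, Real.one_rpow] at h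
  have := (abs_nonneg _).trans h
  linarith

/-- The axis profile is non-increasing on `(0, ∞)`. [folklore] -/
theorem axis_antitone {C η : ℝ} (hC : 0 ≤ C)
    (hb : ∀ x : EuclideanSpace ℝ (Fin 4), x ≠ 0 → |K x| ≤ C * (1 + ‖x‖ ^ (η - 10))) {s t : ℝ}
    (hs : 0 < s) (hst : s ≤ t) : K (EuclideanSpace.single 0 t) ≤ K (EuclideanSpace.single 0 s) :=
  antitone_of_midLogConvex (f := fun t => K (EuclideanSpace.single 0 t)) (axis_nonneg hW hax)
    (fun a b ha hb => by
      have h := axis_logConvex hW hax (a / 2) (b / 2) (half_pos ha) (half_pos hb)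
      rwa [add_halves, add_halves, ← add_div] at h)
    (axis_growth hC hb) hs hst

/-- `K` is bounded by `f (1/2)` off the open unit ball. [folklore] -/
theorem bounded_off_ball {C η : ℝ} (hC : 0 ≤ C)
    (hb : ∀ x : EuclideanSpace ℝ (Fin 4), x ≠ 0 → |K x| ≤ C * (1 + ‖x‖ ^ (η - 10)))
    (x : EuclideanSpace ℝ (Fin 4)) (hx : 1 ≤ ‖x‖) :
    |K x| ≤ K (EuclideanSpace.single 0 (1 / 2)) := by
  obtain ⟨μ, hμ⟩ : ∃ μ : Fin 4, 1 / 2 ≤ |x μ| := by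
    by_contra hcon
    push Not at hcon
    have hsq : ‖x‖ ^ 2 < 1 := by
      rw [EuclideanSpace.real_norm_sq_eq, Fin.sum_univ_four]
      have h0 := hcon 0; have h1 := hcon 1; have h2 := hcon 2; have h3 := hcon 3
      rw [abs_lt] at h0 h1 h2 h3
      nlinarith
    nlinarith [norm_nonneg x]
  have hμ0 : x μ ≠ 0 := by
    intro h0; rw [h0, abs_zero] at hμ; linarith
  exact (dom_axis hW hax μ x hμ0).trans (axis_antitone hW hax hC hb (by norm_num) hμ)

end Kernel

end ExponentReduction

open ExponentReduction in
/-- **Stub 1 · exponent reduction.** The crux's bound `|K x| ≤ C (1 + ‖x‖ ^ (η - 10))` of a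
`W(B₄)`-symmetric kernel, pointwise OS-positive across `x₀ = 0`, can be traded for the exponent
`min η 7`: on the unit ball by antitonicity of `r ↦ ‖x‖ ^ r` for `‖x‖ ≤ 1`, and off the unit ball
because `K` is bounded there (`ExponentReduction.bounded_off_ball`). Continuity and `η > 0` are not
used. [folklore] -/
theorem stub_exponentReduction (K : EuclideanSpace ℝ (Fin 4) → ℝ) (η : ℝ) (_hη : 0 < η)
    (_hc : ContinuousOn K {x | x ≠ 0})
    (hb : ∃ C : ℝ, ∀ x : EuclideanSpace ℝ (Fin 4), x ≠ 0 → |K x| ≤ C * (1 + ‖x‖ ^ (η - 10)))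
    (hW : ∀ R : EuclideanSpace ℝ (Fin 4) ≃ₗᵢ[ℝ] EuclideanSpace ℝ (Fin 4),
      (∀ i : Fin 4, ∃ j : Fin 4, R (EuclideanSpace.single i 1) = EuclideanSpace.single j 1 ∨
        R (EuclideanSpace.single i 1) = -EuclideanSpace.single j 1) →
      ∀ x : EuclideanSpace ℝ (Fin 4), K (R x) = K x)
    (hax : ∀ (m : ℕ) (x : Fin m → EuclideanSpace ℝ (Fin 4)) (c : Fin m → ℝ), (∀ i, 0 < x i 0) →
      0 ≤ ∑ i, ∑ j, c i * c j * K (timeReflection 4 (x i) - x j)) :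
    ∃ C : ℝ, ∀ x : EuclideanSpace ℝ (Fin 4), x ≠ 0 → |K x| ≤ C * (1 + ‖x‖ ^ (min η 7 - 10)) := by
  obtain ⟨C, hC⟩ := hb
  have hC0 : 0 ≤ C := const_nonneg hC
  set B := K (EuclideanSpace.single 0 (1 / 2))
  have hB0 : 0 ≤ B := axis_nonneg hW hax (1 / 2) (by norm_num)
  refine ⟨C + B, fun x hx => ?_⟩
  have hnpos : 0 < ‖x‖ := norm_pos_iff.2 hx
  have hr0 : 0 ≤ ‖x‖ ^ (min η 7 - 10) := Real.rpow_nonneg hnpos.le _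
  by_cases hx1 : ‖x‖ ≤ 1
  · have hmono : ‖x‖ ^ (η - 10) ≤ ‖x‖ ^ (min η 7 - 10) :=
      Real.rpow_le_rpow_of_exponent_ge hnpos hx1 (by linarith [min_le_left η 7])
    calc |K x| ≤ C * (1 + ‖x‖ ^ (η - 10)) := hC x hx
      _ ≤ C * (1 + ‖x‖ ^ (min η 7 - 10)) := by gcongr
      _ ≤ (C + B) * (1 + ‖x‖ ^ (min η 7 - 10)) := by gcongr; linarith
  · have hx1' : 1 ≤ ‖x‖ := (not_le.1 hx1).le
    calc |K x| ≤ B := bounded_off_ball hW hax hC0 hC x hx1'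
      _ ≤ (C + B) * 1 := by linarith
      _ ≤ (C + B) * (1 + ‖x‖ ^ (min η 7 - 10)) :=
          mul_le_mul_of_nonneg_left (by linarith) (by linarith)

end Summit.QuantumFields.YangMills.Cruxes.ShellRigidity.TransverseSmearingPlanarThreshold
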